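import Summits.CriticalPhenomena.PercolationContinuityZ3.Theorems.PercNearOneGluingNoHeavyLowerTailFrontierDecRowsFivePointCells
import Summits.CriticalPhenomena.PercolationContinuityZ3.Theorems.PercNearOneGluingNoHeavyLowerTailFaceCertKernelN
import HarnessLib

/-!
# The 52-cell DICTIONARY for kernel certificates of five-point KEY forms (terminal–unmarked edge step)

Support file (prover seat `prim-facecert`, gen 5; `--supports stmt-CriticalPhenomena-4575`).  No named facts, no sorries, no `native_decide`;
bookkeeping definitions only (`sumExpr`, `cellCode`, `predExpr`, `cellVal`).

PURPOSE.  A facecert/cgring certificate for `K ≥ 0` (`TerminalEdgeInduction.key`, `KeyHypAt(All)`) is a polynomial identity in the 52 cell probabilities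
of the five marked points `v = Fin.snoc x u` (prim-bnk-1 gen 9, `…FrontierDecRowsFivePointCells`: `key_pev_snoc`, `real_pev_eq_sum_cells`), replayed by the
kernel engine `…FaceCertKernelN` (`cert_nonneg`: a valuation `val : ℕ → ℝ`, reflected `Lean.Grind.CommRing.Expr` rows).  This file is the bridge between the two,
INDEPENDENT of any particular certificate:
* `cellCode i` (`i < 52`) — the pattern code of the `i`-th cell in the certificate's cell order (prim-facecert `five.Law(5)` order; table
  `code/gen4/data/cell_pattern_codes.json`), and `cellCodes_eq` (`decide`): the consistent patterns `{m < 1024 | Cons5 m}` are exactly these 52 codes;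
* `cellVal μ v : ℕ → ℝ` — the valuation: `i ↦ μ.real (Cell v (cellCode i))` for `i < 52`, `52 ↦ 1` (the formal total mass `σ`), `0` beyond; nonnegative;
* `predExpr Φ : Expr` — the reflected cell sum of a five-point pattern predicate `Φ`, and **`evalE_predExpr`**:
  `evalE (cellVal μ v) (predExpr Φ) = μ.real (pev Φ v)` for every finite measure `μ` — so a certificate row written with `predExpr`s of its events
  evaluates, under `evalE`, to the row's value at `μ`, and the kernel (`decide +kernel` on `toPPN`) expands the same `predExpr`s into cells by computation;
* `sum_cellVal` : `Σ_{i<52} cellVal μ v i = μ.real univ` (the transfer identities `σ·m = Σ_k x_k·m` of a certificate evaluate to `0` for a probability measure).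
-/

noncomputable section

namespace Summit.CriticalPhenomena.PercolationContinuityZ3.Theorems

namespace TerminalEdgeInduction

open MeasureTheory Literature.Probability.Percolation Literature.Probability.LatticeModels
open PatternCells FaceCertKernelN
open Lean.Grind.CommRing (Expr)
open scoped Classical BigOperators

variable {n : ℕ}

/-! ### Balanced reflected sums of variables -/

/-- Reflected sum of the variables listed in `l`, as a balanced `.add` tree (depth `O(log |l|)`). [folklore] -/
def sumExpr : List ℕ → Expr
  | [] => .num 0
  | [i] => .var i
  | i :: j :: l =>
    let m := (i :: j :: l).length / 2
    .add (sumExpr ((i :: j :: l).take m)) (sumExpr ((i :: j :: l).drop m))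
  termination_by l => l.length
  decreasing_by
    all_goals simp only [List.length_cons, List.length_take, List.length_drop]
    all_goals omega

/-- `evalE v (sumExpr l) = Σ_{i ∈ l} v i`. [folklore] -/
theorem evalE_sumExpr {R : Type*} [CommRing R] (v : ℕ → R) : ∀ l : List ℕ, evalE v (sumExpr l) = (l.map v).sum
  | [] => by simp [sumExpr, evalE]
  | [i] => by simp [sumExpr, evalE]
  | i :: j :: l => by
    rw [sumExpr]
    simp only [evalE]
    rw [evalE_sumExpr v _, evalE_sumExpr v _, ← List.sum_append, ← List.map_append, List.take_append_drop]
  termination_by l => l.length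
  decreasing_by
    all_goals simp only [List.length_cons, List.length_take, List.length_drop]
    all_goals omega

/-! ### The 52 cell codes -/

/-- Pattern codes of the 52 five-point cells, in the certificate cell order `abcu|y, abcyu, abcy|u, …, a|b|c|y|u`
(pair bits `(0,1),(0,2),(0,3),(0,4),(1,2),(1,3),(1,4),(2,3),(2,4),(3,4)`, points `a,b,c,y,u = 0..4`). [this work] -/
def cellCodeList : List ℕ :=
  [347, 1023, 183, 531, 19, 201, 73, 621, 293, 37, 257, 897, 129, 513, 1, 298, 266, 910, 198, 134, 66, 610, 34, 514, 2, 184, 24, 40,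
   136, 8, 540, 524, 340, 20, 68, 260, 4, 336, 1008, 176, 528, 16, 192, 64, 608, 288, 32, 256, 896, 128, 512, 0]

/-- The code of the `i`-th cell (`0` beyond `52`; note cell `51` genuinely has code `0`). [this work] -/
def cellCode (i : ℕ) : ℕ := cellCodeList.getD i 0

/-- There are 52 cells. [this work] -/
theorem cellCodeList_length : cellCodeList.length = 52 := by decide

/-- The cell codes are pairwise distinct. [this work] -/
theorem cellCodeList_nodup : cellCodeList.Nodup := by decide

set_option maxRecDepth 100000 in
/-- **The consistent patterns are exactly the 52 cell codes.** [this work] -/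
theorem cellCodes_eq : ((Finset.range 1024).filter fun m => Cons5 m = true) = cellCodeList.toFinset := by decide

/-- `cellCode` is injective on `0..51`. [this work] -/
theorem cellCode_inj {i j : ℕ} (hi : i < 52) (hj : j < 52) (h : cellCode i = cellCode j) : i = j := by
  have hn := cellCodeList_nodup
  rw [List.nodup_iff_injective_get] at hn
  have hi' : i < cellCodeList.length := by rw [cellCodeList_length]; exact hi
  have hj' : j < cellCodeList.length := by rw [cellCodeList_length]; exact hj
  have h' : cellCodeList.get ⟨i, hi'⟩ = cellCodeList.get ⟨j, hj'⟩ := by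
    simp only [cellCode, List.getD_eq_getElem?_getD, List.getElem?_eq_getElem hi', List.getElem?_eq_getElem hj',
      Option.getD_some] at h
    exact h
  exact congrArg Fin.val (hn h')

/-- List sums over a filtered `range` as `Finset` sums. [folklore] -/
theorem sum_map_filter_range {M : Type*} [AddCommMonoid M] (k : ℕ) (p : ℕ → Bool) (f : ℕ → M) :
    (((List.range k).filter p).map f).sum = ∑ i ∈ (Finset.range k).filter (fun i => p i = true), f i := by
  rw [← List.sum_toFinset f (List.nodup_range.filter p), List.toFinset_filter, List.toFinset_range]

/-! ### The valuation and reflected predicate events -/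

/-- **The certificate valuation**: cell probabilities at `0..51`, the formal total mass `σ ↦ 1` at `52`, `0` beyond. [this work] -/
def cellVal (μ : Measure (BondConfig (Fin n))) (v : Fin 5 → Fin n) (i : ℕ) : ℝ :=
  if i < 52 then μ.real (Cell v (cellCode i)) else if i = 52 then 1 else 0

/-- The valuation is nonnegative. [this work] -/
theorem cellVal_nonneg (μ : Measure (BondConfig (Fin n))) (v : Fin 5 → Fin n) : ∀ i, i < 256 → 0 ≤ cellVal μ v i := by
  intro i _
  unfold cellVal
  split_ifs
  · exact measureReal_nonneg
  · exact zero_le_one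
  · exact le_rfl

/-- `cellVal` at the formal total mass. [this work] -/
theorem cellVal_sigma (μ : Measure (BondConfig (Fin n))) (v : Fin 5 → Fin n) : cellVal μ v 52 = 1 := by
  simp [cellVal]

/-- `cellVal` at a cell index. [this work] -/
theorem cellVal_of_lt (μ : Measure (BondConfig (Fin n))) (v : Fin 5 → Fin n) {i : ℕ} (hi : i < 52) :
    cellVal μ v i = μ.real (Cell v (cellCode i)) := by
  simp [cellVal, hi]

/-- The cell indices whose pattern satisfies `Φ`. [this work] -/
def predCells (Φ : (Fin 5 → Fin 5 → Bool) → Bool) : List ℕ :=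
  (List.range 52).filter fun i => Φ (mrel (cellCode i))

/-- **Reflected cell sum of a five-point pattern predicate.** [this work] -/
def predExpr (Φ : (Fin 5 → Fin 5 → Bool) → Bool) : Expr := sumExpr (predCells Φ)

/-- **Dictionary lemma**: the reflected cell sum of `Φ` evaluates to `μ(pev Φ v)`. [this work] -/
theorem evalE_predExpr (μ : Measure (BondConfig (Fin n))) [IsFiniteMeasure μ] (v : Fin 5 → Fin n)
    (Φ : (Fin 5 → Fin 5 → Bool) → Bool) :
    evalE (cellVal μ v) (predExpr Φ) = μ.real (pev Φ v) := by
  rw [predExpr, evalE_sumExpr, real_pev_eq_sum_cells μ Φ v]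
  -- rewrite the index set of the cell expansion through the 52 codes
  have hset : ((Finset.range 1024).filter fun m => Cons5 m = true ∧ Φ (mrel m) = true) =
      ((Finset.range 52).filter fun i => Φ (mrel (cellCode i)) = true).image cellCode := by
    have h1 : ((Finset.range 1024).filter fun m => Cons5 m = true ∧ Φ (mrel m) = true) =
        (((Finset.range 1024).filter fun m => Cons5 m = true).filter fun m => Φ (mrel m) = true) := by
      rw [Finset.filter_filter]
    rw [h1, cellCodes_eq]
    ext m
    simp only [Finset.mem_filter, List.mem_toFinset, Finset.mem_image, Finset.mem_range]
    constructor
    · rintro ⟨hm, hΦ⟩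
      obtain ⟨i, hi, rfl⟩ := List.getElem_of_mem hm
      refine ⟨i, ⟨by rw [cellCodeList_length] at hi; exact hi, ?_⟩, ?_⟩
      · have : cellCode i = cellCodeList[i] := by
          simp only [cellCode, List.getD_eq_getElem?_getD, List.getElem?_eq_getElem hi, Option.getD_some]
        rw [this]; exact hΦ
      · simp only [cellCode, List.getD_eq_getElem?_getD, List.getElem?_eq_getElem hi, Option.getD_some]
    · rintro ⟨i, ⟨hi, hΦ⟩, rfl⟩
      refine ⟨?_, hΦ⟩
      have hi' : i < cellCodeList.length := by rw [cellCodeList_length]; exact hi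
      have : cellCode i = cellCodeList[i] := by
        simp only [cellCode, List.getD_eq_getElem?_getD, List.getElem?_eq_getElem hi', Option.getD_some]
      rw [this]; exact List.getElem_mem hi'
  rw [hset, Finset.sum_image (fun i hi j hj h => cellCode_inj (Finset.mem_range.1 (Finset.mem_filter.1 hi).1)
    (Finset.mem_range.1 (Finset.mem_filter.1 hj).1) h)]
  -- both sides are now sums over the same index set
  rw [predCells, sum_map_filter_range]
  refine Finset.sum_congr rfl fun i hi => ?_
  rw [cellVal_of_lt]
  exact Finset.mem_range.1 (Finset.mem_filter.1 hi).1

/-- **Total mass**: the 52 cell values sum to `μ(univ)`. [this work] -/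
theorem sum_cellVal (μ : Measure (BondConfig (Fin n))) [IsFiniteMeasure μ] (v : Fin 5 → Fin n) :
    ∑ i ∈ Finset.range 52, cellVal μ v i = μ.real Set.univ := by
  have h := evalE_predExpr μ v (fun _ => true)
  have hpev : pev (fun _ : Fin 5 → Fin 5 → Bool => true) v = Set.univ := by
    ext ω; simp [mem_pev_iff]
  rw [hpev, predExpr, evalE_sumExpr, predCells, sum_map_filter_range] at h
  rw [← h]
  exact Finset.sum_congr (by ext i; simp) fun _ _ => rfl

/-! ### Reflected rows: Harris forms, Sahi cubics, monomials and transfer identities -/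

/-- The conjunction of pattern predicates is the intersection of their events (re-export for `simp`). -/
theorem pev_andPat' (Φ Ψ : (Fin 5 → Fin 5 → Bool) → Bool) (v : Fin 5 → Fin n) : pev (andPat Φ Ψ) v = pev Φ v ∩ pev Ψ v :=
  pev_andPat Φ Ψ v

/-- **Reflected Harris form** `μ(Φ ∧ Ψ)·σ − μ(Φ)·μ(Ψ)`. [this work] -/
def harrisExpr (Φ Ψ : (Fin 5 → Fin 5 → Bool) → Bool) : Expr :=
  .sub (.mul (predExpr (andPat Φ Ψ)) (.var 52)) (.mul (predExpr Φ) (predExpr Ψ))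

/-- Value of the reflected Harris form. [this work] -/
theorem evalE_harrisExpr (μ : Measure (BondConfig (Fin n))) [IsFiniteMeasure μ] (v : Fin 5 → Fin n)
    (Φ Ψ : (Fin 5 → Fin 5 → Bool) → Bool) :
    evalE (cellVal μ v) (harrisExpr Φ Ψ) = μ.real (pev Φ v ∩ pev Ψ v) - μ.real (pev Φ v) * μ.real (pev Ψ v) := by
  simp only [harrisExpr, evalE, evalE_predExpr, cellVal_sigma, pev_andPat', mul_one]

/-- **Harris row, two decreasing pattern events** (`prodBernoulli_harris_lower`). [folklore] -/
theorem harrisExpr_nonneg_of_lower (w : Sym2 (Fin n) → unitInterval) (v : Fin 5 → Fin n)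
    (Φ Ψ : (Fin 5 → Fin 5 → Bool) → Bool) (hΦ : IsLowerSet (pev Φ v)) (hΨ : IsLowerSet (pev Ψ v)) :
    0 ≤ evalE (cellVal (prodBernoulli w) v) (harrisExpr Φ Ψ) := by
  rw [evalE_harrisExpr]
  have h := prodBernoulli_harris_lower w hΦ hΨ MeasurableSet.of_discrete MeasurableSet.of_discrete
  linarith

/-- **Harris row, two increasing pattern events** (`prodBernoulli_harris`). [folklore] -/
theorem harrisExpr_nonneg_of_upper (w : Sym2 (Fin n) → unitInterval) (v : Fin 5 → Fin n)
    (Φ Ψ : (Fin 5 → Fin 5 → Bool) → Bool) (hΦ : IsUpperSet (pev Φ v)) (hΨ : IsUpperSet (pev Ψ v)) :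
    0 ≤ evalE (cellVal (prodBernoulli w) v) (harrisExpr Φ Ψ) := by
  rw [evalE_harrisExpr]
  have h := prodBernoulli_harris w hΦ hΨ MeasurableSet.of_discrete MeasurableSet.of_discrete
  linarith

/-- **Reflected (homogenised) Sahi cubic** `2·μ(Φ₁Φ₂Φ₃)·σ² + μ(Φ₁)μ(Φ₂)μ(Φ₃) − (μ(Φ₁)μ(Φ₂Φ₃) + μ(Φ₂)μ(Φ₁Φ₃) + μ(Φ₃)μ(Φ₁Φ₂))·σ`. [this work] -/
def e3Expr (Φ₁ Φ₂ Φ₃ : (Fin 5 → Fin 5 → Bool) → Bool) : Expr :=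
  .sub
    (.add (.mul (.mul (.mul (.num 2) (predExpr (andPat (andPat Φ₁ Φ₂) Φ₃))) (.var 52)) (.var 52))
      (.mul (.mul (predExpr Φ₁) (predExpr Φ₂)) (predExpr Φ₃)))
    (.mul (.add (.add (.mul (predExpr Φ₁) (predExpr (andPat Φ₂ Φ₃))) (.mul (predExpr Φ₂) (predExpr (andPat Φ₁ Φ₃))))
      (.mul (predExpr Φ₃) (predExpr (andPat Φ₁ Φ₂)))) (.var 52))

/-- Value of the reflected Sahi cubic: `sahiE3 μ`. [this work] -/
theorem evalE_e3Expr (μ : Measure (BondConfig (Fin n))) [IsFiniteMeasure μ] (v : Fin 5 → Fin n)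
    (Φ₁ Φ₂ Φ₃ : (Fin 5 → Fin 5 → Bool) → Bool) :
    evalE (cellVal μ v) (e3Expr Φ₁ Φ₂ Φ₃) = sahiE3 μ (pev Φ₁ v) (pev Φ₂ v) (pev Φ₃ v) := by
  simp only [e3Expr, evalE, evalE_predExpr, cellVal_sigma, pev_andPat', sahiE3_def, mul_one]
  push_cast
  ring

/-- Reflected product of the variables in `l` (a monomial). [folklore] -/
def monoExpr : List ℕ → Expr
  | [] => .num 1
  | i :: l => .mul (.var i) (monoExpr l)

/-- `evalE v (monoExpr l) = ∏_{i ∈ l} v i`. [folklore] -/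
theorem evalE_monoExpr {R : Type*} [CommRing R] (v : ℕ → R) : ∀ l : List ℕ, evalE v (monoExpr l) = (l.map v).prod
  | [] => by simp [monoExpr, evalE]
  | i :: l => by rw [monoExpr]; simp only [evalE, List.map_cons, List.prod_cons, evalE_monoExpr v l]

/-- **Reflected transfer identity** `σ·m − (Σ_{i<52} x_i)·m` for a monomial `m`. [this work] -/
def transferExpr (mono : List ℕ) : Expr :=
  .sub (.mul (.var 52) (monoExpr mono)) (.mul (sumExpr (List.range 52)) (monoExpr mono))

/-- A transfer identity evaluates to `0` for a probability measure (total cell mass `1`). [this work] -/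
theorem evalE_transferExpr (μ : Measure (BondConfig (Fin n))) [IsProbabilityMeasure μ] (v : Fin 5 → Fin n) (mono : List ℕ) :
    evalE (cellVal μ v) (transferExpr mono) = 0 := by
  have hs : evalE (cellVal μ v) (sumExpr (List.range 52)) = 1 := by
    rw [evalE_sumExpr, ← List.sum_toFinset _ List.nodup_range, List.toFinset_range, sum_cellVal, probReal_univ]
  simp only [transferExpr, evalE, cellVal_sigma, hs, sub_self]

/-! ### The KEY target as a reflected cell polynomial -/

/-- **Reflected KEY form** of a three-event pattern row at a (terminal, unmarked) pair, mirroring `key_pev_snoc` term by term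
(`L` = the lift along the pair, `P₁ P₂ P₃` = the row predicates read on five points). [this work] -/
def keyExpr (L : ((Fin 5 → Fin 5 → Bool) → Bool) → ((Fin 5 → Fin 5 → Bool) → Bool)) (P₁ P₂ P₃ : (Fin 5 → Fin 5 → Bool) → Bool) : Expr :=
  let m := fun Φ => predExpr Φ
  .sub
    (.add
      (.sub
        (.add (.mul (.num 2) (m (L (andPat (andPat P₁ P₂) P₃))))
          (.add (.add (.mul (.mul (m (L P₁)) (m P₂)) (m P₃)) (.mul (.mul (m P₁) (m (L P₂))) (m P₃))) (.mul (.mul (m P₁) (m P₂)) (m (L P₃)))))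
        (.mul (.num 2) (.mul (.mul (m P₁) (m P₂)) (m P₃))))
      (.add (.add (.mul (m P₁) (m (andPat P₂ P₃))) (.mul (m P₂) (m (andPat P₁ P₃)))) (.mul (m P₃) (m (andPat P₁ P₂)))))
    (.add (.add (.add (.add (.add
      (.mul (m (L P₁)) (m (andPat P₂ P₃))) (.mul (m P₁) (m (L (andPat P₂ P₃)))))
      (.mul (m (L P₂)) (m (andPat P₁ P₃)))) (.mul (m P₂) (m (L (andPat P₁ P₃)))))
      (.mul (m (L P₃)) (m (andPat P₁ P₂)))) (.mul (m P₃) (m (L (andPat P₁ P₂)))))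

/-- **The reflected KEY form evaluates to `key μ⁰ μ¹`** at the cell valuation of `μ⁰` on the five points `Fin.snoc x u`. [this work] -/
theorem evalE_keyExpr_snoc (w : Sym2 (Fin n) → unitInterval) (x : Fin 4 → Fin n) (u : Fin n) (i₀ : Fin 4)
    (Φ₁ Φ₂ Φ₃ : (Fin 4 → Fin 4 → Bool) → Bool) :
    evalE (cellVal (prodBernoulli (Function.update w s(x i₀, u) 0)) (Fin.snoc x u))
        (keyExpr (liftPat (Fin.castSucc i₀) (Fin.last 4)) (ext4 Φ₁) (ext4 Φ₂) (ext4 Φ₃)) =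
      key (prodBernoulli (Function.update w s(x i₀, u) 0)) (prodBernoulli (Function.update w s(x i₀, u) 1))
        (pev Φ₁ x) (pev Φ₂ x) (pev Φ₃ x) := by
  rw [key_pev_snoc]
  simp only [keyExpr, evalE, evalE_predExpr]
  push_cast
  ring

/-- **Pull-back of the contracted law to five-point cells**: an event of the marked points under `μ¹ = μ_{w[e↦1]}` is the lifted event under
`μ⁰ = μ_{w[e↦0]}` (`real_update_one_connEvent` in `pev` form), so rows of the law `μ¹` are rows in the SAME 52 cells. [this work] -/
theorem real_one_pev_snoc (w : Sym2 (Fin n) → unitInterval) (x : Fin 4 → Fin n) (u : Fin n) (i₀ : Fin 4)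
    (Ψ : (Fin 5 → Fin 5 → Bool) → Bool) :
    (prodBernoulli (Function.update w s(x i₀, u) 1)).real (pev Ψ (Fin.snoc x u)) =
      (prodBernoulli (Function.update w s(x i₀, u) 0)).real (pev (liftPat (Fin.castSucc i₀) (Fin.last 4) Ψ) (Fin.snoc x u)) := by
  have hx : (Fin.snoc x u : Fin 5 → Fin n) (Fin.castSucc i₀) = x i₀ := by rw [Fin.snoc_castSucc]
  have hu : (Fin.snoc x u : Fin 5 → Fin n) (Fin.last 4) = u := by rw [Fin.snoc_last]
  rw [← pev_liftPat, hx, hu, pev_def, real_update_one_connEvent]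

end TerminalEdgeInduction

end Summit.CriticalPhenomena.PercolationContinuityZ3.Theorems
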